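import Mathlib.RingTheory.Ideal.Operations
import Mathlib.RingTheory.Ideal.Maps
import Mathlib.LinearAlgebra.Span.Basic
import Mathlib.Algebra.Algebra.Hom
import HarnessLib

/-!
# MEMO-24 §1 (c), second half: a CO-FREE symbol module has no β-branch — in `𝕎 = Hom_Λ(𝕋, Λ)` the
# generator `Φ₀` of `𝕎[𝔓]` (for a component `𝕋/𝔓 ≅ Λ`) satisfies `Φ₀(1) = 1`, hence `Φ₀ ∉ 𝔪_Λ𝕎`
# (cell `bsd-eis`, seat `bsd-line-x2-p2` gen 2, D-0154 KEY row 5; route `EisensteinPrimes`, crux 4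
# `BSDpOnCellC` stmt-BirchSwinnertonDyer-19034 line b1 v10 / crux 3; memo `HOME/cgshw-MEMO-24.md` §1 (c);
# companion p611136 `…GorensteinDefectCriterion`)

HONEST FRAMING (cell `bsd-eis`, run/shared/lean/pub/bsd-eis/): pure commutative algebra over an
arbitrary commutative ring `Λ` with an ideal `𝔪 ≠ ⊤` and a `Λ`-algebra `T` (Mathlib only); NO Hecke
algebra, Hida family or `Λ`-adic symbol module is constructed or asserted — the memo's identification
«`T = 𝕋_𝔪`, `𝕎 = Hom_Λ(𝕋_𝔪, Λ)` = the co-free model of the ordinary `Λ`-adic symbols, `π : 𝕋_𝔪 → 𝕀 = Λ`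
the branch through `f_E`» stays memo-level; nothing is booked; no label or count moves; BSD and the main
conjectures are proved for no curve. Helper attached to stmt-BirchSwinnertonDyer-19034 (`--supports`).

## The point

MEMO-24 §1 (c): «`Φ̄₀ = 0 ⟺ … 𝕎/ΛΦ₀` is NOT `Λ`-free; so `n ≥ 2` is necessary, and `𝕎 ≅ 𝕋_𝔪` (free) or
`𝕎 ≅ Hom_Λ(𝕋_𝔪, Λ)` (co-free) both EXCLUDE it — a GORENSTEIN-DEFECT phenomenon». p611136 typed the first
half. Here the CO-FREE exclusion, for any commutative `Λ`, ideal `𝔪 ≠ ⊤`, `Λ`-algebra `T` and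
`Λ`-algebra map `π : T → Λ` (the component; `𝔓 = ker π`, `T/𝔓 ≅ Λ`), with `W := T →ₗ[Λ] Λ`:

* §1 `dual_apply_mem_of_mem_smul_top` — every `Φ ∈ 𝔪·W` takes values in `𝔪`; hence
  `not_mem_smul_top_of_apply_eq_one`: `Φ t = 1` for some `t` ⟹ `Φ ∉ 𝔪·W`.
* §2 the `𝔓`-torsion of `W`: `Φ₀ := π` (as a `Λ`-linear form) kills `𝔓·T`
  (`toLinearMap_apply_mul_eq_zero`), and EVERY `Λ`-linear form killing `𝔓·T` is `f(1) • Φ₀`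
  (`eq_smul_of_forall_apply_mul_eq_zero`): `W[𝔓] = Λ·Φ₀`.
* §3 `algHom_toLinearMap_not_mem_smul_top` — `Φ₀(1) = 1`, so `Φ₀ ∉ 𝔪·W`: the co-free model carries
  NO β-branch; `not_mem_smul_top_of_linearEquiv` transports this along any `Λ`-linear isomorphism
  `W ≃ W'` (so a `𝕋`-module isomorphism `𝕋_𝔪 ≅ Hom_Λ(𝕋_𝔪, Λ)` — Gorenstein-ness — gives the free case).

References: [EmertonPollackWeston2006] §2.6 (Gorenstein hypothesis in the Hida-family formalism; context);
cell memo cgshw MEMO-24 §1 (c) e922e989f5e38c02.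
-/

set_option autoImplicit false
set_option linter.dupNamespace false -- the summit namespace `…BirchSwinnertonDyer.BirchSwinnertonDyer.Theorems` (Sub = Summit, D-0017) trips it

namespace Summit.BirchSwinnertonDyer.BirchSwinnertonDyer.Theorems.GorensteinDefectCoFree

variable {Λ : Type*} [CommRing Λ] {M : Type*} [AddCommGroup M] [Module Λ M]

/-! ## §1. Elements of `𝔪·Hom_Λ(M, Λ)` take values in `𝔪` -/

/-- Every `Φ ∈ 𝔪 · Hom_Λ(M, Λ)` takes all its values in `𝔪`. [folklore] -/
theorem dual_apply_mem_of_mem_smul_top (𝔪 : Ideal Λ) {Φ : M →ₗ[Λ] Λ}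
    (hΦ : Φ ∈ 𝔪 • (⊤ : Submodule Λ (M →ₗ[Λ] Λ))) (m : M) : Φ m ∈ 𝔪 := by
  induction hΦ using Submodule.smul_induction_on' with
  | smul r hr f _ => rw [LinearMap.smul_apply, smul_eq_mul]; exact 𝔪.mul_mem_right _ hr
  | add f _ g _ hf hg => rw [LinearMap.add_apply]; exact 𝔪.add_mem hf hg

/-- **A linear form taking the value `1` is not in `𝔪 · Hom_Λ(M, Λ)`** (`𝔪 ≠ ⊤`). [folklore] -/
theorem not_mem_smul_top_of_apply_eq_one {𝔪 : Ideal Λ} (h𝔪 : 𝔪 ≠ ⊤) {Φ : M →ₗ[Λ] Λ} {m : M}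
    (hm : Φ m = 1) : Φ ∉ 𝔪 • (⊤ : Submodule Λ (M →ₗ[Λ] Λ)) := fun hΦ ↦
  h𝔪 ((Ideal.eq_top_iff_one 𝔪).mpr (hm ▸ dual_apply_mem_of_mem_smul_top 𝔪 hΦ m))

/-- Membership in `𝔪·W` is transported by `Λ`-linear isomorphisms (so is its failure). [folklore] -/
theorem mem_smul_top_iff_of_linearEquiv {W W' : Type*} [AddCommGroup W] [Module Λ W]
    [AddCommGroup W'] [Module Λ W'] (e : W ≃ₗ[Λ] W') (𝔪 : Ideal Λ) (Φ : W) :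
    Φ ∈ 𝔪 • (⊤ : Submodule Λ W) ↔ e Φ ∈ 𝔪 • (⊤ : Submodule Λ W') := by
  constructor
  · intro h
    have := Submodule.mem_map_of_mem (f := (e : W →ₗ[Λ] W')) h
    rwa [Submodule.map_smul'', Submodule.map_top, LinearEquiv.range] at this
  · intro h
    have := Submodule.mem_map_of_mem (f := (e.symm : W' →ₗ[Λ] W)) h
    rwa [Submodule.map_smul'', Submodule.map_top, LinearEquiv.range, LinearEquiv.coe_coe,
      LinearEquiv.symm_apply_apply] at this

/-! ## §2. The `𝔓`-torsion of the co-free module `Hom_Λ(T, Λ)` for a component `π : T → Λ` -/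

section Component

variable {T : Type*} [CommRing T] [Algebra Λ T] (π : T →ₐ[Λ] Λ)

/-- `Φ₀ := π` kills `𝔓·T`, `𝔓 = ker π`: `Φ₀ ∈ W[𝔓]`. [folklore] -/
theorem toLinearMap_apply_mul_eq_zero {a : T} (ha : π a = 0) (t : T) : π.toLinearMap (a * t) = 0 := by
  rw [AlgHom.toLinearMap_apply, map_mul, ha, zero_mul]

/-- `t ≡ π(t)·1 (mod 𝔓)`: `π (t − π t • 1) = 0`. [folklore] -/
theorem apply_sub_smul_one (t : T) : π (t - π t • (1 : T)) = 0 := by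
  rw [map_sub, map_smul, map_one, smul_eq_mul, mul_one, sub_self]

/-- **`W[𝔓] = Λ·Φ₀`**: every `Λ`-linear form `f : T → Λ` killing `𝔓·T` (`𝔓 = ker π`) is `f(1) • π`.
[folklore] -/
theorem eq_smul_of_forall_apply_mul_eq_zero (f : T →ₗ[Λ] Λ)
    (hf : ∀ a : T, π a = 0 → ∀ t : T, f (a * t) = 0) : f = f 1 • π.toLinearMap := by
  ext t
  have h0 : f (t - π t • (1 : T)) = 0 := by
    have := hf _ (apply_sub_smul_one π t) 1
    rwa [mul_one] at this
  rw [map_sub, map_smul, sub_eq_zero] at h0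
  rw [LinearMap.smul_apply, AlgHom.toLinearMap_apply, h0, smul_eq_mul, smul_eq_mul, mul_comm]

/-- The `𝔓`-torsion, as the span: `{f | f kills 𝔓·T} = Λ ∙ Φ₀`. [folklore] -/
theorem mem_span_toLinearMap_iff (f : T →ₗ[Λ] Λ) :
    f ∈ Submodule.span Λ {π.toLinearMap} ↔ ∀ a : T, π a = 0 → ∀ t : T, f (a * t) = 0 := by
  constructor
  · intro h a ha t
    obtain ⟨c, rfl⟩ := Submodule.mem_span_singleton.mp h
    rw [LinearMap.smul_apply, toLinearMap_apply_mul_eq_zero π ha, smul_zero]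
  · intro h
    rw [eq_smul_of_forall_apply_mul_eq_zero π f h]
    exact Submodule.smul_mem _ _ (Submodule.mem_span_singleton_self _)

/-! ## §3. The co-free model has no β-branch -/

/-- **MEMO-24 §1 (c), co-free case: `Φ₀ ∉ 𝔪·Hom_Λ(T, Λ)`** for every ideal `𝔪 ≠ ⊤` of `Λ`, because
`Φ₀(1) = π(1) = 1`. With §2 (`Φ₀` generates the `𝔓`-torsion) this is: the co-free `Λ`-adic symbol
module admits no β-branch (`Φ̄₀ ≠ 0`), whatever the Hecke algebra. [folklore] -/
theorem algHom_toLinearMap_not_mem_smul_top {𝔪 : Ideal Λ} (h𝔪 : 𝔪 ≠ ⊤) :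
    π.toLinearMap ∉ 𝔪 • (⊤ : Submodule Λ (T →ₗ[Λ] Λ)) :=
  not_mem_smul_top_of_apply_eq_one h𝔪 (m := (1 : T)) (by rw [AlgHom.toLinearMap_apply, map_one])

/-- **Transport (the free case under Gorenstein-ness).** If `e : Hom_Λ(T, Λ) ≃ₗ[Λ] W'` is any `Λ`-linear
isomorphism (e.g. induced by a `𝕋`-module isomorphism `𝕋 ≅ Hom_Λ(𝕋, Λ)`), then `e Φ₀ ∉ 𝔪·W'`.
[folklore] -/
theorem not_mem_smul_top_of_linearEquiv {W' : Type*} [AddCommGroup W'] [Module Λ W']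
    (e : (T →ₗ[Λ] Λ) ≃ₗ[Λ] W') {𝔪 : Ideal Λ} (h𝔪 : 𝔪 ≠ ⊤) :
    e π.toLinearMap ∉ 𝔪 • (⊤ : Submodule Λ W') := fun h ↦
  algHom_toLinearMap_not_mem_smul_top π h𝔪 ((mem_smul_top_iff_of_linearEquiv e 𝔪 _).mpr h)

end Component

end Summit.BirchSwinnertonDyer.BirchSwinnertonDyer.Theorems.GorensteinDefectCoFree
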